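import Literature.Analysis.FluidPDE.KNSSMollifiedWeak
import Mathlib.Analysis.Distribution.AEEqOfIntegralContDiff
import HarnessLib

/-!
# KNSS 2009, Lemma 3.1, step 1 (continued): the slice identity for mollified bounded weak solutions

Analysis/FluidPDE proofs file, continuation of `KNSSMollifiedWeak` (Koch–Nadirashvili–Seregin–Šverák,
Acta Math. 203 (2009) = arXiv:0709.3599v1, §3 p. 7 and Lemma 3.1): from the mollified weak
identity `∫ (⟪V, ∂ₜΦ⟫ + frobeniusPairing E(DₓΦ, W) + ν⟪V, ΔₓΦ⟫) = 0` for all space–time test fields `Φ`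
with solenoidal slices supported in times `[t₁, t₂] ⊂ (a + r, T − r)` we pass to the
**slice identity**: for every `t ∈ (a + r, T − r)` and every smooth compactly supported
divergence-free `φ`,

  `∫ ⟪∂ₜV(t), φ⟫ = ν ∫ ⟪V(t), Δφ⟫ + ∫ frobeniusPairing E(Dφ, W(t))`

(`IsBoundedWeakNSSolutionOn.integral_inner_timeDeriv_mollified`), i.e. the smooth bounded field
`V = k ⋆ ũ` is a (classical-in-`x`) solution of the linear Stokes system with the smooth bounded
forcing tensor `W = k ⋆ (ũ ⊗ ũ)` against solenoidal tests — the form in which KNSS's Lemma 3.1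
("for a fixed `f ∈ L^∞_{x,t}` let `u ∈ L^∞_{x,t}` be any weak solution of (3.1)") is applied to
the mollified solution `u_ε`. Proof: `Φ = η ⊗ φ` (`integral_mollified_tensor_test`), Fubini,
integration by parts in `t` (`t ↦ ∫⟪V(t), φ⟫` is `C¹` with derivative `∫⟪∂ₜV(t), φ⟫`,
`hasDerivAt_integral_inner_family_of_bound`), du Bois-Reymond
(`IsOpen.ae_eq_zero_of_integral_contDiff_smul_eq_zero`) and continuity in `t`. Everything is
proved, in any finite-dimensional `E`, for every viscosity `ν`.

## References

* G. Koch, N. Nadirashvili, G. Seregin, V. Šverák, *Liouville theorems for the Navier–Stokes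
  equations and applications*, Acta Math. 203 (2009) = arXiv:0709.3599v1: §3 p. 7 (weak
  solutions of the Stokes system), Lemma 3.1 and its proof. [KochNadirashviliSereginSverak2009]
-/

noncomputable section

open MeasureTheory TopologicalSpace Set Function Filter ContinuousLinearMap Metric
  InnerProductSpace
open _root_.Topology
open scoped ENNReal NNReal Convolution Laplacian RealInnerProductSpace ContDiff

namespace Literature.Analysis.FluidPDE

variable {E : Type*} [NormedAddCommGroup E] [InnerProductSpace ℝ E] [FiniteDimensional ℝ E]
  [MeasurableSpace E] [BorelSpace E]

/-! ### Slice functionals of bounded continuous families -/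

section SliceTools

variable {Vf : ℝ → E → E} {B : ℝ} {φ : E → E}

/-- **Continuity in time of `s ↦ ∫⟪V(s), φ⟫`** for a jointly continuous, bounded family `V` and
a continuous compactly supported `φ` (dominated convergence, bound `B‖φ‖`). [folklore] -/
theorem continuous_integral_inner_family_of_bound (hVc : Continuous (uncurry Vf))
    (hVb : ∀ s y, ‖Vf s y‖ ≤ B) (hφc : Continuous φ) (hφs : HasCompactSupport φ) :
    Continuous fun s => ∫ y, ⟪Vf s y, φ y⟫ := by
  refine continuous_of_dominated (fun s => ?_) (fun s => Eventually.of_forall fun y => ?_)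
    ((hφc.norm.integrable_of_hasCompactSupport hφs.norm).const_mul B) (Eventually.of_forall fun y => ?_)
  · exact ((hVc.comp (Continuous.prodMk_right s)).inner hφc).aestronglyMeasurable
  · exact (norm_inner_le_norm _ _).trans (mul_le_mul_of_nonneg_right (hVb s y) (norm_nonneg _))
  · exact (hVc.comp (Continuous.prodMk_left y)).inner continuous_const

/-- **Continuity in time of `s ↦ ∫ frobeniusPairing E(L, W(s))`** for a jointly continuous, bounded
operator family `W` and a continuous compactly supported operator field `L`. [folklore] -/
theorem continuous_integral_frobeniusPairing_family_of_bound {Wf : ℝ → E → E →L[ℝ] E}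
    (hWc : Continuous (uncurry Wf)) (hWb : ∀ s y, ‖Wf s y‖ ≤ B) {L : E → E →L[ℝ] E}
    (hLc : Continuous L) (hLs : HasCompactSupport L) :
    Continuous fun s => ∫ y, frobeniusPairing E (L y) (Wf s y) := by
  have hTP : Continuous (uncurry fun (L : E →L[ℝ] E) (T : E →L[ℝ] E) => frobeniusPairing E L T) :=
    (frobeniusPairing E).continuous₂
  obtain ⟨CP, hCP0, hCP⟩ := exists_norm_frobeniusPairing_le (E := E)
  have hB : 0 ≤ B := (norm_nonneg _).trans (hWb 0 0)
  refine continuous_of_dominated (fun s => ?_) (fun s => Eventually.of_forall fun y => ?_)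
    (((hLc.norm.integrable_of_hasCompactSupport hLs.norm).const_mul CP).mul_const B)
    (Eventually.of_forall fun y => ?_)
  · exact (hTP.comp₂ hLc (hWc.comp (Continuous.prodMk_right s))).aestronglyMeasurable
  · exact (hCP _ _).trans (mul_le_mul_of_nonneg_left (hWb s y) (by positivity))
  · exact hTP.comp₂ continuous_const (hWc.comp (Continuous.prodMk_left y))

/-- **Differentiation in time under the spatial integral**: for a jointly `C¹` family `V` whose
time derivative is bounded and a continuous compactly supported `φ`,
`d/ds ∫⟪V(s), φ⟫ = ∫⟪∂ₜV(s), φ⟫`. [folklore] -/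
theorem hasDerivAt_integral_inner_family_of_bound (hVs : ContDiff ℝ 1 (uncurry Vf))
    (hTb : ∀ s y, ‖timeDeriv Vf s y‖ ≤ B) (hφc : Continuous φ) (hφs : HasCompactSupport φ) (s : ℝ) :
    HasDerivAt (fun σ => ∫ y, ⟪Vf σ y, φ y⟫) (∫ y, ⟪timeDeriv Vf s y, φ y⟫) s := by
  have hd : ∀ z : ℝ × E, DifferentiableAt ℝ (uncurry Vf) z := fun z => (hVs.differentiable one_ne_zero) z
  have hVc : Continuous (uncurry Vf) := hVs.continuous
  -- the time derivative is `D(uncurry V)(·)(1, 0)`, jointly continuous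
  have hTrepr : (fun z : ℝ × E => timeDeriv Vf z.1 z.2) = fun z => fderiv ℝ (uncurry Vf) z (1, 0) := by
    funext z
    rw [show Vf = curry (uncurry Vf) from rfl]
    exact timeDeriv_curry_eq_fderiv (hd z)
  have hTc : Continuous fun z : ℝ × E => timeDeriv Vf z.1 z.2 := by
    rw [hTrepr]; exact (hVs.continuous_fderiv one_ne_zero).clm_apply continuous_const
  have hVd : ∀ σ y, HasDerivAt (fun σ' => Vf σ' y) (timeDeriv Vf σ y) σ := fun σ y => by
    have h1 : DifferentiableAt ℝ (fun σ' : ℝ => ((σ', y) : ℝ × E)) σ :=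
      differentiableAt_id.prodMk (differentiableAt_const y)
    have hdiff : DifferentiableAt ℝ (uncurry Vf ∘ fun σ' : ℝ => ((σ', y) : ℝ × E)) σ :=
      (hd (σ, y)).comp σ h1
    exact hdiff.hasDerivAt
  refine (hasDerivAt_integral_of_dominated_loc_of_deriv_le (μ := volume)
    (F := fun σ y => ⟪Vf σ y, φ y⟫) (F' := fun σ y => ⟪timeDeriv Vf σ y, φ y⟫)
    (bound := fun y => B * ‖φ y‖) (ball_mem_nhds s zero_lt_one) (Eventually.of_forall fun σ => ?_) ?_ ?_
    (Eventually.of_forall fun y σ _ => ?_) ((hφc.norm.integrable_of_hasCompactSupport hφs.norm).const_mul B)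
    (Eventually.of_forall fun y σ _ => ?_)).2
  · exact ((hVc.comp (Continuous.prodMk_right σ)).inner hφc).aestronglyMeasurable
  · exact ((hVc.comp (Continuous.prodMk_right s)).inner hφc).integrable_of_hasCompactSupport
      (hφs.mono fun y hy h0 => hy (by change ⟪Vf s y, φ y⟫ = 0; rw [h0, inner_zero_right]))
  · exact ((hTc.comp (Continuous.prodMk_right s)).inner hφc).aestronglyMeasurable
  · exact (norm_inner_le_norm _ _).trans (mul_le_mul_of_nonneg_right (hTb σ y) (norm_nonneg _))
  · simpa using (hVd σ y).inner ℝ (hasDerivAt_const σ (φ y))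

end SliceTools

/-! ### Tensor tests `η ⊗ φ` in the mollified identity -/

section TensorTest

variable {a T ν : ℝ} {u : ℝ → E → E} {k : ℝ × E → ℝ} {r : ℝ}

omit [MeasurableSpace E] [BorelSpace E] in
/-- The tensor test field `Φ(s, y) = η(s) φ(y)`: smooth, compactly supported, vanishing for
`s ∉ tsupport η`, with `∂ₜΦ = η' ⊗ φ`, `DₓΦ = η ⊗ Dφ`, `ΔₓΦ = η ⊗ Δφ` and divergence-free
slices when `φ` is. [folklore] -/
theorem tensorTest_props {η : ℝ → ℝ} (hη : ContDiff ℝ ∞ η) (hηs : HasCompactSupport η)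
    {φ : E → E} (hφ : ContDiff ℝ ∞ φ) (hφs : HasCompactSupport φ) :
    ContDiff ℝ ∞ (uncurry fun s y => η s • φ y) ∧
      HasCompactSupport (uncurry fun s y => η s • φ y) ∧
      (∀ s y, timeDeriv (fun s y => η s • φ y) s y = deriv η s • φ y) ∧
      (∀ s y, fderiv ℝ (fun y => η s • φ y) y = η s • fderiv ℝ φ y) ∧
      (∀ s y, (Δ (fun y => η s • φ y)) y = η s • (Δ φ) y) := by
  refine ⟨(hη.comp contDiff_fst).smul (hφ.comp contDiff_snd), ?_, fun s y => ?_, fun s y => ?_,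
    fun s y => ?_⟩
  · refine HasCompactSupport.intro (hηs.prod hφs) fun z hz => ?_
    change η z.1 • φ z.2 = 0
    rcases not_and_or.1 (fun h => hz (mem_prod.2 h)) with h1 | h2
    · rw [image_eq_zero_of_notMem_tsupport h1, zero_smul]
    · rw [image_eq_zero_of_notMem_tsupport h2, smul_zero]
  · change deriv (fun s => η s • φ y) s = deriv η s • φ y
    exact deriv_smul_const (hη.differentiable (by simp) s) (φ y)
  · exact fderiv_fun_const_smul ((hφ.differentiable (by simp)) y) (η s)
  · exact laplacian_smul (η s) ((contDiff_infty.1 hφ 2).contDiffAt)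

/-- **The mollified identity on tensor tests.** For `Φ = η ⊗ φ` with `η` smooth, supported in
`[t₁, t₂]`, `a < t₁ − r`, `t₂ + r < T`, and `φ` a smooth compactly supported divergence-free field:
`∫ (η'(s) ∫⟪V(s), φ⟫ + η(s) (∫ frobeniusPairing E(Dφ, W(s)) + ν ∫⟪V(s), Δφ⟫)) ds = 0`.
[cite: KochNadirashviliSereginSverak2009, §3 p. 7 (arXiv:0709.3599v1)] -/
theorem IsBoundedWeakNSSolutionOn.integral_mollified_tensor_test
    (hu : IsBoundedWeakNSSolutionOn (Ioo a T) isOpen_Ioo ν u) {M : ℝ} (hM0 : 0 ≤ M)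
    (hM : ∀ t ∈ Ioo a T, ∀ x, ‖u t x‖ ≤ M) (hk : ContDiff ℝ ∞ k)
    (hkr : ∀ w, w ∉ closedBall (0 : ℝ × E) r → k w = 0) {φ : E → E}
    (hφ : ContDiff ℝ ∞ φ) (hφs : HasCompactSupport φ) (hdiv : VectorCalculus.IsDivFree φ)
    {η : ℝ → ℝ} (hη : ContDiff ℝ ∞ η) (hηs : HasCompactSupport η) {t₁ t₂ : ℝ}
    (hηt : tsupport η ⊆ Icc t₁ t₂) (ha : a < t₁ - r) (hT : t₂ + r < T) :
    ∫ s, (deriv η s * (∫ y, ⟪stMollify k (zeroExt (slab E (Ioo a T) isOpen_Ioo) u) s y, φ y⟫) +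
      η s * ((∫ y, frobeniusPairing E (fderiv ℝ φ y) (stMollify k (zeroExt (slab E (Ioo a T) isOpen_Ioo) (dyadField u)) s y)) +
        ν * ∫ y, ⟪stMollify k (zeroExt (slab E (Ioo a T) isOpen_Ioo) u) s y, (Δ φ) y⟫)) = 0 := by
  obtain ⟨hΦ, hΦc, hΦt', hΦD, hΦL⟩ := tensorTest_props hη hηs hφ hφs
  have hΦt : ∀ s, s ∉ Icc t₁ t₂ → ∀ y, (fun s y => η s • φ y) s y = 0 := fun s hs y => by
    change η s • φ y = 0
    rw [image_eq_zero_of_notMem_tsupport (fun h => hs (hηt h)), zero_smul]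
  have hΦdiv : ∀ s, VectorCalculus.IsDivFree (fun y => η s • φ y) := fun s y => by
    rw [divergence_const_smul_apply ((hφ.differentiable (by simp)) y), hdiv y, mul_zero]
  have key := hu.integral_mollified_eq_zero hM0 hM hk hkr hΦ hΦc hΦdiv hΦt ha hT
  -- abbreviations
  set V : ℝ → E → E := stMollify k (zeroExt (slab E (Ioo a T) isOpen_Ioo) u) with hV
  set W : ℝ → E → E →L[ℝ] E := stMollify k (zeroExt (slab E (Ioo a T) isOpen_Ioo) (dyadField u)) with hW
  -- smoothness and bounds of `V`, `W`
  have hQm : MeasurableSet ((slab E (Ioo a T) isOpen_Ioo : Opens (ℝ × E)) : Set (ℝ × E)) :=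
    (slab E (Ioo a T) isOpen_Ioo).isOpen.measurableSet
  have huzm : AEStronglyMeasurable (zeroExt (slab E (Ioo a T) isOpen_Ioo) u) volume :=
    (aestronglyMeasurable_indicator_iff hQm).2 hu.aestronglyMeasurable
  have hRm : AEStronglyMeasurable (zeroExt (slab E (Ioo a T) isOpen_Ioo) (dyadField u)) volume :=
    (aestronglyMeasurable_indicator_iff hQm).2
      (continuous_rankOne_self.comp_aestronglyMeasurable hu.aestronglyMeasurable)
  have huzb : ∀ w, ‖zeroExt (slab E (Ioo a T) isOpen_Ioo) u w‖ ≤ M := fun w => by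
    by_cases hw : w ∈ ((slab E (Ioo a T) isOpen_Ioo : Opens (ℝ × E)) : Set (ℝ × E))
    · rw [zeroExt_of_mem _ hw]; exact hM w.1 (mem_slab.1 hw) w.2
    · rw [zeroExt_of_not_mem _ hw, norm_zero]; exact hM0
  have hRb : ∀ w, ‖zeroExt (slab E (Ioo a T) isOpen_Ioo) (dyadField u) w‖ ≤ M ^ 2 := fun w => by
    by_cases hw : w ∈ ((slab E (Ioo a T) isOpen_Ioo : Opens (ℝ × E)) : Set (ℝ × E))
    · rw [zeroExt_of_mem _ hw]
      rw [dyadField, norm_rankOne, ← sq]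
      exact pow_le_pow_left₀ (norm_nonneg _) (hM w.1 (mem_slab.1 hw) w.2) 2
    · rw [zeroExt_of_not_mem _ hw, norm_zero]; positivity
  have hkc : HasCompactSupport k := hasCompactSupport_of_closedBall hkr
  have hVc : Continuous (uncurry V) := (contDiff_uncurry_stMollify hk hkc
    ((memLp_top_of_bound huzm M (Eventually.of_forall huzb)).locallyIntegrable le_top)).continuous
  have hWc : Continuous (uncurry W) := (contDiff_uncurry_stMollify hk hkc
    ((memLp_top_of_bound hRm (M ^ 2) (Eventually.of_forall hRb)).locallyIntegrable le_top)).continuous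
  -- the integrand of `key`, pointwise
  have hTP : Continuous (uncurry fun (L : E →L[ℝ] E) (T : E →L[ℝ] E) => frobeniusPairing E L T) :=
    (frobeniusPairing E).continuous₂
  set F : ℝ → E → ℝ := fun s y => deriv η s * ⟪V s y, φ y⟫ +
    η s * (frobeniusPairing E (fderiv ℝ φ y) (W s y) + ν * ⟪V s y, (Δ φ) y⟫) with hF
  have hpt : ∀ z : ℝ × E, ⟪V z.1 z.2, timeDeriv (fun s y => η s • φ y) z.1 z.2⟫ +
      frobeniusPairing E (fderiv ℝ ((fun s y => η s • φ y) z.1) z.2) (W z.1 z.2) +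
      ν * ⟪V z.1 z.2, (Δ ((fun s y => η s • φ y) z.1)) z.2⟫ = F z.1 z.2 := fun z => by
    simp only [hF]
    rw [hΦt' z.1 z.2, hΦD z.1 z.2, hΦL z.1 z.2, inner_smul_right, inner_smul_right, map_smul,
      smul_apply, smul_eq_mul]
    ring
  -- `F` is continuous with compact support on `ℝ × E`
  have hηc : Continuous η := hη.continuous
  have hη'c : Continuous (deriv η) := hη.continuous_deriv (by simp)
  have hφc : Continuous φ := hφ.continuous
  have hDφc : Continuous (fderiv ℝ φ) := hφ.continuous_fderiv (by simp)
  have hΔφc : Continuous (Δ φ) := by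
    have : Δ φ = fun x => ∑ i, fderiv ℝ (fun y => fderiv ℝ φ y (stdOrthonormalBasis ℝ E i)) x
        (stdOrthonormalBasis ℝ E i) := by
      rw [laplacian_eq_iteratedFDeriv_orthonormalBasis φ (stdOrthonormalBasis ℝ E)]
      funext x
      exact Finset.sum_congr rfl fun i _ => iteratedFDeriv_two_apply_self (contDiff_infty.1 hφ 2) x _
    rw [this]
    refine continuous_finsetSum _ fun i _ => ?_
    have h1 : ContDiff ℝ ∞ fun y => fderiv ℝ φ y (stdOrthonormalBasis ℝ E i) :=
      (hφ.fderiv_right (m := ∞) (by exact_mod_cast le_rfl)).clm_apply contDiff_const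
    exact (h1.continuous_fderiv (by simp)).clm_apply continuous_const
  have hFc : Continuous (uncurry F) := by
    have hV' : Continuous fun z : ℝ × E => V z.1 z.2 := hVc
    have hW' : Continuous fun z : ℝ × E => W z.1 z.2 := hWc
    change Continuous fun z : ℝ × E => deriv η z.1 * ⟪V z.1 z.2, φ z.2⟫ +
      η z.1 * (frobeniusPairing E (fderiv ℝ φ z.2) (W z.1 z.2) + ν * ⟪V z.1 z.2, (Δ φ) z.2⟫)
    refine ((hη'c.comp continuous_fst).mul (hV'.inner (hφc.comp continuous_snd))).add
      ((hηc.comp continuous_fst).mul ((hTP.comp₂ (hDφc.comp continuous_snd) hW').add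
        (continuous_const.mul (hV'.inner (hΔφc.comp continuous_snd)))))
  have hDφs : HasCompactSupport (fderiv ℝ φ) := hφs.fderiv ℝ
  have hΔφs : HasCompactSupport (Δ φ) := by
    rw [laplacian_eq_iteratedFDeriv_orthonormalBasis φ (stdOrthonormalBasis ℝ E)]
    refine HasCompactSupport.intro (hφs.iteratedFDeriv (𝕜 := ℝ) 2) fun x hx => ?_
    simp [image_eq_zero_of_notMem_tsupport hx]
  have hFs : HasCompactSupport (uncurry F) := by
    refine HasCompactSupport.intro (((hηs.deriv).union hηs).prod ((hφs.union hDφs).union hΔφs))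
      fun z hz => ?_
    change deriv η z.1 * ⟪V z.1 z.2, φ z.2⟫ +
      η z.1 * (frobeniusPairing E (fderiv ℝ φ z.2) (W z.1 z.2) + ν * ⟪V z.1 z.2, (Δ φ) z.2⟫) = 0
    rcases not_and_or.1 (fun h => hz (mem_prod.2 h)) with h1 | h2
    · rw [mem_union, not_or] at h1
      rw [image_eq_zero_of_notMem_tsupport h1.1, image_eq_zero_of_notMem_tsupport h1.2]; ring
    · simp only [mem_union, not_or] at h2
      rw [image_eq_zero_of_notMem_tsupport h2.1.1, image_eq_zero_of_notMem_tsupport h2.1.2,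
        image_eq_zero_of_notMem_tsupport h2.2, inner_zero_right, map_zero]
      simp
  -- Fubini and the inner integrals
  have hkey' : ∫ z : ℝ × E, F z.1 z.2 = 0 := by
    rw [← key]
    exact integral_congr_ae (Eventually.of_forall fun z => (hpt z).symm)
  have hFi : Integrable (uncurry F) ((volume : Measure ℝ).prod (volume : Measure E)) :=
    hFc.integrable_of_hasCompactSupport hFs
  have hprod : ∫ z : ℝ × E, F z.1 z.2 = ∫ s, ∫ y, F s y := integral_prod (uncurry F) hFi
  have hinner : ∀ s, ∫ y, F s y = deriv η s * (∫ y, ⟪V s y, φ y⟫) +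
      η s * ((∫ y, frobeniusPairing E (fderiv ℝ φ y) (W s y)) + ν * ∫ y, ⟪V s y, (Δ φ) y⟫) := by
    intro s
    have hVs' : Continuous fun y => V s y := hVc.comp (Continuous.prodMk_right s)
    have hWs' : Continuous fun y => W s y := hWc.comp (Continuous.prodMk_right s)
    have i1 : Integrable (fun y => ⟪V s y, φ y⟫) := (hVs'.inner hφc).integrable_of_hasCompactSupport
      (hφs.mono fun y hy h0 => hy (by change ⟪V s y, φ y⟫ = 0; rw [h0, inner_zero_right]))
    have i2 : Integrable (fun y => frobeniusPairing E (fderiv ℝ φ y) (W s y)) :=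
      (hTP.comp₂ hDφc hWs').integrable_of_hasCompactSupport (hDφs.mono fun y hy h0 => hy
        (by change frobeniusPairing E (fderiv ℝ φ y) (W s y) = 0; rw [h0, map_zero]; rfl))
    have i3 : Integrable (fun y => ⟪V s y, (Δ φ) y⟫) := (hVs'.inner hΔφc).integrable_of_hasCompactSupport
      (hΔφs.mono fun y hy h0 => hy (by change ⟪V s y, (Δ φ) y⟫ = 0; rw [h0, inner_zero_right]))
    have i23 : Integrable (fun y => frobeniusPairing E (fderiv ℝ φ y) (W s y) + ν * ⟪V s y, (Δ φ) y⟫) :=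
      i2.add (i3.const_mul ν)
    have e1 := integral_add (i1.const_mul (deriv η s)) (i23.const_mul (η s))
    have e2 := integral_add i2 (i3.const_mul ν)
    rw [MeasureTheory.integral_const_mul, MeasureTheory.integral_const_mul] at e1
    rw [MeasureTheory.integral_const_mul] at e2
    rw [e2] at e1
    exact e1
  rw [hprod] at hkey'
  simpa only [hinner] using hkey'

/-- A compact subset of an open interval lies in a compact subinterval `[t₁, t₂]` with
`lo < t₁` and `t₂ < hi` (given a point of the interval to handle the empty case). [folklore] -/
theorem exists_Icc_superset_of_isCompact_subset_Ioo {K : Set ℝ} (hK : IsCompact K) {lo hi t : ℝ}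
    (hKJ : K ⊆ Ioo lo hi) (ht : t ∈ Ioo lo hi) :
    ∃ t₁ t₂, lo < t₁ ∧ t₂ < hi ∧ K ⊆ Icc t₁ t₂ := by
  rcases K.eq_empty_or_nonempty with hKe | hKn
  · exact ⟨t, t, ht.1, ht.2, by simp [hKe]⟩
  · refine ⟨sInf K, sSup K, (hKJ (hK.sInf_mem hKn)).1, (hKJ (hK.sSup_mem hKn)).2, fun x hx =>
      ⟨csInf_le hK.bddBelow hx, le_csSup hK.bddAbove hx⟩⟩

/-- **The slice identity: the mollified velocity solves the Stokes system with forcing tensor `W`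
against solenoidal tests, at every time.** Let `u` be a bounded weak Navier–Stokes solution on
`(a, T) × E` (solenoidal space–time test class) with `‖u‖ ≤ M`, `k` a smooth kernel vanishing
outside `closedBall 0 r`, `V = k ⋆ 𝟙_Q u`, `W = k ⋆ 𝟙_Q (u ⊗ u)`. Then for every
`t ∈ (a + r, T − r)` and every smooth compactly supported divergence-free `φ`:
`∫ ⟪∂ₜV(t), φ⟫ = ν ∫ ⟪V(t), Δφ⟫ + ∫ frobeniusPairing E(Dφ, W(t))`.
(KNSS 2009, §3 p. 7: the weak form `∫∫ u(φ_t + Δφ) = ∫∫ f_k φ,_k` of the Stokes system (3.1) with a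
bounded divergence-form right-hand side, here satisfied classically in `x` by the mollified
solution.) [cite: KochNadirashviliSereginSverak2009, §3 p. 7 and proof of Lemma 3.1 (arXiv:0709.3599v1)] -/
theorem IsBoundedWeakNSSolutionOn.integral_inner_timeDeriv_mollified
    (hu : IsBoundedWeakNSSolutionOn (Ioo a T) isOpen_Ioo ν u) {M : ℝ} (hM0 : 0 ≤ M)
    (hM : ∀ t ∈ Ioo a T, ∀ x, ‖u t x‖ ≤ M) (hk : ContDiff ℝ ∞ k)
    (hkr : ∀ w, w ∉ closedBall (0 : ℝ × E) r → k w = 0) {t : ℝ} (ht : t ∈ Ioo (a + r) (T - r))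
    {φ : E → E} (hφ : ContDiff ℝ ∞ φ) (hφs : HasCompactSupport φ) (hdiv : VectorCalculus.IsDivFree φ) :
    ∫ y, ⟪timeDeriv (stMollify k (zeroExt (slab E (Ioo a T) isOpen_Ioo) u)) t y, φ y⟫ =
      ν * (∫ y, ⟪stMollify k (zeroExt (slab E (Ioo a T) isOpen_Ioo) u) t y, (Δ φ) y⟫) +
        ∫ y, frobeniusPairing E (fderiv ℝ φ y) (stMollify k (zeroExt (slab E (Ioo a T) isOpen_Ioo) (dyadField u)) t y) := by
  set J : Set ℝ := Ioo (a + r) (T - r) with hJ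
  have hJo : IsOpen J := isOpen_Ioo
  have hkc : HasCompactSupport k := hasCompactSupport_of_closedBall hkr
  have hQm : MeasurableSet ((slab E (Ioo a T) isOpen_Ioo : Opens (ℝ × E)) : Set (ℝ × E)) :=
    (slab E (Ioo a T) isOpen_Ioo).isOpen.measurableSet
  -- the data and their mollifications
  set uz : ℝ × E → E := zeroExt (slab E (Ioo a T) isOpen_Ioo) u with huz
  set R : ℝ × E → E →L[ℝ] E := zeroExt (slab E (Ioo a T) isOpen_Ioo) (dyadField u) with hR
  have huzm : AEStronglyMeasurable uz volume := (aestronglyMeasurable_indicator_iff hQm).2 hu.aestronglyMeasurable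
  have hRm : AEStronglyMeasurable R volume := (aestronglyMeasurable_indicator_iff hQm).2
    (continuous_rankOne_self.comp_aestronglyMeasurable hu.aestronglyMeasurable)
  have huzb : ∀ w, ‖uz w‖ ≤ M := fun w => by
    by_cases hw : w ∈ ((slab E (Ioo a T) isOpen_Ioo : Opens (ℝ × E)) : Set (ℝ × E))
    · rw [huz, zeroExt_of_mem _ hw]; exact hM w.1 (mem_slab.1 hw) w.2
    · rw [huz, zeroExt_of_not_mem _ hw, norm_zero]; exact hM0
  have hRb : ∀ w, ‖R w‖ ≤ M ^ 2 := fun w => by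
    by_cases hw : w ∈ ((slab E (Ioo a T) isOpen_Ioo : Opens (ℝ × E)) : Set (ℝ × E))
    · rw [hR, zeroExt_of_mem _ hw]
      rw [dyadField, norm_rankOne, ← sq]
      exact pow_le_pow_left₀ (norm_nonneg _) (hM w.1 (mem_slab.1 hw) w.2) 2
    · rw [hR, zeroExt_of_not_mem _ hw, norm_zero]; positivity
  have huzl : LocallyIntegrable uz volume :=
    (memLp_top_of_bound huzm M (Eventually.of_forall huzb)).locallyIntegrable le_top
  have hRl : LocallyIntegrable R volume :=
    (memLp_top_of_bound hRm (M ^ 2) (Eventually.of_forall hRb)).locallyIntegrable le_top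
  set V : ℝ → E → E := stMollify k uz with hV
  set W : ℝ → E → E →L[ℝ] E := stMollify k R with hW
  have hVs : ContDiff ℝ ∞ (uncurry V) := contDiff_uncurry_stMollify hk hkc huzl
  have hVc : Continuous (uncurry V) := hVs.continuous
  have hWc : Continuous (uncurry W) := (contDiff_uncurry_stMollify hk hkc hRl).continuous
  have hki : Integrable k (volume : Measure (ℝ × E)) := hk.continuous.integrable_of_hasCompactSupport hkc
  have hVb : ∀ s y, ‖V s y‖ ≤ (∫ w, ‖k w‖) * M := fun s y => norm_stMollify_le_of_bound hki huzb s y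
  have hWb : ∀ s y, ‖W s y‖ ≤ (∫ w, ‖k w‖) * M ^ 2 := fun s y => norm_stMollify_le_of_bound hki hRb s y
  -- the time derivative of `V`
  set k₁ : ℝ × E → ℝ := fun w => fderiv ℝ k w (1, 0) with hk₁
  have hk₁d : ContDiff ℝ ∞ k₁ := contDiff_fderiv_apply_const hk _
  have hk₁s : HasCompactSupport k₁ := hasCompactSupport_fderiv_apply_const hkc _
  have hk₁i : Integrable k₁ (volume : Measure (ℝ × E)) := hk₁d.continuous.integrable_of_hasCompactSupport hk₁s
  have hTD : timeDeriv V = stMollify k₁ uz := by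
    funext s y; exact timeDeriv_stMollify hk hkc huzl s y
  have hTDc : Continuous (uncurry (timeDeriv V)) := by
    rw [hTD]; exact (contDiff_uncurry_stMollify hk₁d hk₁s huzl).continuous
  have hTDb : ∀ s y, ‖timeDeriv V s y‖ ≤ (∫ w, ‖k₁ w‖) * M := fun s y => by
    rw [hTD]; exact norm_stMollify_le_of_bound hk₁i huzb s y
  -- the test data
  have hφc : Continuous φ := hφ.continuous
  have hDφc : Continuous (fderiv ℝ φ) := hφ.continuous_fderiv (by simp)
  have hDφs : HasCompactSupport (fderiv ℝ φ) := hφs.fderiv ℝ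
  have hΔφc : Continuous (Δ φ) := by
    have : Δ φ = fun x => ∑ i, fderiv ℝ (fun y => fderiv ℝ φ y (stdOrthonormalBasis ℝ E i)) x
        (stdOrthonormalBasis ℝ E i) := by
      rw [laplacian_eq_iteratedFDeriv_orthonormalBasis φ (stdOrthonormalBasis ℝ E)]
      funext x
      exact Finset.sum_congr rfl fun i _ => iteratedFDeriv_two_apply_self (contDiff_infty.1 hφ 2) x _
    rw [this]
    refine continuous_finsetSum _ fun i _ => ?_
    have h1 : ContDiff ℝ ∞ fun y => fderiv ℝ φ y (stdOrthonormalBasis ℝ E i) :=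
      (hφ.fderiv_right (m := ∞) (by exact_mod_cast le_rfl)).clm_apply contDiff_const
    exact (h1.continuous_fderiv (by simp)).clm_apply continuous_const
  have hΔφs : HasCompactSupport (Δ φ) := by
    rw [laplacian_eq_iteratedFDeriv_orthonormalBasis φ (stdOrthonormalBasis ℝ E)]
    refine HasCompactSupport.intro (hφs.iteratedFDeriv (𝕜 := ℝ) 2) fun x hx => ?_
    simp [image_eq_zero_of_notMem_tsupport hx]
  -- the slice functionals
  set g : ℝ → ℝ := fun s => ∫ y, ⟪V s y, φ y⟫ with hg
  set g' : ℝ → ℝ := fun s => ∫ y, ⟪timeDeriv V s y, φ y⟫ with hg'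
  set h₁ : ℝ → ℝ := fun s => ∫ y, ⟪V s y, (Δ φ) y⟫ with hh₁
  set h₂ : ℝ → ℝ := fun s => ∫ y, frobeniusPairing E (fderiv ℝ φ y) (W s y) with hh₂
  have hgd : ∀ s, HasDerivAt g (g' s) s := fun s =>
    hasDerivAt_integral_inner_family_of_bound (hVs.of_le (by exact_mod_cast le_top)) hTDb hφc hφs s
  have hgc : Continuous g := continuous_integral_inner_family_of_bound hVc hVb hφc hφs
  have hg'c : Continuous g' := continuous_integral_inner_family_of_bound hTDc hTDb hφc hφs
  have hh₁c : Continuous h₁ := continuous_integral_inner_family_of_bound hVc hVb hΔφc hΔφs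
  have hh₂c : Continuous h₂ := continuous_integral_frobeniusPairing_family_of_bound hWc hWb hDφc hDφs
  -- du Bois-Reymond
  set f : ℝ → ℝ := fun s => ν * h₁ s + h₂ s - g' s with hf
  have hfc : Continuous f := ((continuous_const.mul hh₁c).add hh₂c).sub hg'c
  have hae : ∀ᵐ s ∂(volume : Measure ℝ), s ∈ J → f s = 0 := by
    refine hJo.ae_eq_zero_of_integral_contDiff_smul_eq_zero
      (hfc.locallyIntegrable.locallyIntegrableOn J) fun η hη hηs hηJ => ?_
    obtain ⟨t₁, t₂, h1, h2, hηt⟩ := exists_Icc_superset_of_isCompact_subset_Ioo hηs hηJ ht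
    have htest := hu.integral_mollified_tensor_test hM0 hM hk hkr hφ hφs hdiv hη hηs hηt
      (by linarith) (by linarith)
    -- integration by parts in time: `∫ η g' = -∫ η' g`
    have hηc : Continuous η := hη.continuous
    have hη'c : Continuous (deriv η) := hη.continuous_deriv (by simp)
    have hmulInt : ∀ {p q : ℝ → ℝ}, Continuous p → HasCompactSupport p → Continuous q →
        Integrable (p * q) (volume : Measure ℝ) := fun hp hps hq =>
      (hp.mul hq).integrable_of_hasCompactSupport hps.mul_right
    have hibp : ∫ s, η s * g' s = -∫ s, deriv η s * g s :=
      integral_mul_deriv_eq_deriv_mul_of_integrable (u := η) (u' := deriv η) (v := g) (v' := g')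
        (fun s _ => (hη.differentiable (by simp) s).hasDerivAt) (fun s _ => hgd s)
        (hmulInt hηc hηs hg'c) (hmulInt hη'c hηs.deriv hgc) (hmulInt hηc hηs hgc)
    -- assemble `∫ η f = ν ∫ η h₁ + ∫ η h₂ - ∫ η g' = ∫ (η' g + η (h₂ + ν h₁)) = 0`
    have i1 : Integrable (fun s => η s * h₁ s) := hmulInt hηc hηs hh₁c
    have i2 : Integrable (fun s => η s * h₂ s) := hmulInt hηc hηs hh₂c
    have i3 : Integrable (fun s => η s * g' s) := hmulInt hηc hηs hg'c
    have i4 : Integrable (fun s => deriv η s * g s) := hmulInt hη'c hηs.deriv hgc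
    have e1 : ∫ s, η s • f s = ν * (∫ s, η s * h₁ s) + (∫ s, η s * h₂ s) - ∫ s, η s * g' s := by
      have : (fun s => η s • f s) = fun s => (ν * (η s * h₁ s) + η s * h₂ s) - η s * g' s := by
        funext s; simp only [hf, smul_eq_mul]; ring
      rw [this]
      have s1 := integral_sub ((i1.const_mul ν).add i2) i3
      have s2 := integral_add (i1.const_mul ν) i2
      simp only [Pi.add_apply] at s1
      rw [s2, MeasureTheory.integral_const_mul] at s1
      exact s1
    have e2 : ∫ s, (deriv η s * g s + η s * (h₂ s + ν * h₁ s)) =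
        (∫ s, deriv η s * g s) + ((∫ s, η s * h₂ s) + ν * ∫ s, η s * h₁ s) := by
      have : (fun s => deriv η s * g s + η s * (h₂ s + ν * h₁ s)) =
          fun s => deriv η s * g s + (η s * h₂ s + ν * (η s * h₁ s)) := by
        funext s; ring
      rw [this]
      have s1 := integral_add i4 (i2.add (i1.const_mul ν))
      have s2 := integral_add i2 (i1.const_mul ν)
      simp only [Pi.add_apply] at s1
      rw [s2, MeasureTheory.integral_const_mul] at s1
      exact s1
    rw [e1, hibp]
    have e3 : (∫ s, deriv η s * g s) + ((∫ s, η s * h₂ s) + ν * ∫ s, η s * h₁ s) = 0 := by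
      rw [← e2]; exact htest
    linarith
  have hzero : f t = 0 := by
    have h1 : (fun s => f s) =ᵐ[volume.restrict J] fun _ => (0 : ℝ) :=
      (ae_restrict_iff' hJo.measurableSet).2 hae
    exact Measure.eqOn_open_of_ae_eq h1 hJo hfc.continuousOn continuousOn_const ht
  have hft : ν * h₁ t + h₂ t - g' t = 0 := hzero
  linarith

end TensorTest

end Literature.Analysis.FluidPDE

end
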